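import Literature.NumberTheory.ComplexMultiplication.MainTheoremCMArtinCorrespondent
import Literature.NumberTheory.ComplexMultiplication.ReflexNormIdelesTransitivity
import Literature.NumberTheory.AdelicBaseChange.IdeleNormIdeals
import HarnessLib

/-!
# The reflex-norm bridge `g_𝐡(N_{E/E*}(1_∞, s)) = N_{E,Φ}(s)` and Thm. 18.6 in the reciprocity-element currency

Informal companion: [[ReflexNormFinitePartBridge.md]] (this file is the Lean half).

Two currencies for «the reflex norm of a finite idèle `s` of a number field `E ⊇ E*(Φ)`» coexist in the tree:
(18.6 side) `reflexNormFinitePart K Φ E* (ideleRelNorm E* E (finiteIdeles E s))` — Shimura's `g(s)_𝐡` at the idèle norm of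
`(1_∞, s)` (★ `shimura1998_thm18_6_family_of_isArtinCorrespondent`); (reciprocity side) `reflexNormFiniteIdele K Φ E s` — Milne's
`N_{E,Φ}` on finite idèles, through which ★ `CMStructure.cmRecipMatrix` is typed.  §1 proves they are EQUAL ([MilneCM] Prop. 1.23 (7)
on finite idèles + the finite-part bookkeeping); §2 restates the main theorem of complex multiplication for a family over
`E ⊇ E*(Φᵢ)` with the lattices `N_{E,Φᵢ}(s)·𝔞ᵢ` — the form the CM-moduli reading of `SiegelRationalModel.IsCanonical` consumes.
-/

noncomputable section

open scoped Classical nonZeroDivisors NumberField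
open CategoryTheory NumberField IsDedekindDomain

namespace Literature.NumberTheory.ComplexMultiplication

open Literature.AlgebraicGeometry.Motives (CMType AbelianVariety)
open Literature.NumberTheory.GaloisRepresentations (ideleGroup)
open Literature.NumberTheory.NumberFields.IdeleAction (ideleMulEquiv)
open Literature.NumberTheory.AdelicBaseChange (ideleRelNorm finitePart_ideleRelNorm)
open Literature.AlgebraicGeometry.ShimuraVarieties.UnitaryCanonicalModel (IsArtinCorrespondent)

/-! ### §1. The bridge -/

/-- **`g_𝐡(N_{E/E*}(1_∞, s)) = N_{E,Φ}(s)`** for a finite idèle `s` of `E ⊇ E*(Φ)` (the `E*`-algebra structure on `E` being the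
inclusion): Shimura's finite reflex norm of the idèle norm of `(1_∞, s)` is Milne's reflex norm `N_{E,Φ}` of `s` on finite idèles.
[cite: MilneCM2006, Ch. I §1 Prop. 1.23 (7) and Rem. 1.25] [cite: Shimura1998, §18.5 p. 124 («g(s)»)] -/
theorem reflexNormFinitePart_ideleRelNorm_finiteIdeles (K : Type) [Field K] [NumberField K] [IsCMField K] (Φ : CMType K)
    [NumberField (traceField Φ)] (E : IntermediateField ℚ ℂ) [NumberField E] (hE : traceField Φ ≤ E)
    (s : (FiniteAdeleRing (𝓞 E) E)ˣ) :
    letI : Algebra (traceField Φ) E := (IntermediateField.inclusion hE).toRingHom.toAlgebra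
    reflexNormFinitePart K Φ (traceField Φ) (ideleRelNorm (traceField Φ) E (finiteIdeles E s)) =
      reflexNormFiniteIdele K Φ E s := by
  letI : Algebra (traceField Φ) E := (IntermediateField.inclusion hE).toRingHom.toAlgebra
  haveI : IsScalarTower (traceField Φ) E ℂ := IsScalarTower.of_algebraMap_eq fun _ => rfl
  rw [reflexNormFinitePart_apply, finitePart_reflexNormIdele, finitePart_ideleRelNorm, finitePart_finiteIdeles,
    ← reflexNormFiniteIdele_eq_reflexNormFiniteIdele_traceField_finiteIdeleRelNorm]

/-! ### §2. Thm. 18.6 for a family, lattices `N_{E,Φᵢ}(s)·𝔞ᵢ` -/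

/-- Transport of the family form of 18.6 along a renaming of the reflex-norm tuple. [folklore] -/
private theorem family_of_eq (h186 : shimura1998_thm18_6)
    {I : Type} (K : I → Type) [∀ i, Field (K i)] [∀ i, NumberField (K i)] [∀ i, IsCMField (K i)]
    (Φ : ∀ i, CMType (K i)) [∀ i, NumberField (traceField (Φ i))]
    (E : IntermediateField ℚ ℂ) [NumberField E] (hE : ∀ i, traceField (Φ i) ≤ E)
    (𝔞 : ∀ i, (FractionalIdeal (𝓞 (K i))⁰ (K i))ˣ) (A : I → AbelianVariety ℂ)
    (ιA : ∀ i, 𝓞 (K i) →+* End (A i)) (ξ : ∀ i, CMTypeUniformization (Φ i) (𝔞 i) (A i) (ιA i))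
    (σ : ℂ ≃ₐ[E] ℂ) (s : (FiniteAdeleRing (𝓞 E) E)ˣ) (hs : IsArtinCorrespondent E (algebraMap E ℂ) s σ.toRingEquiv)
    (t : ∀ i, (FiniteAdeleRing (𝓞 (K i)) (K i))ˣ)
    (ht : (fun i =>
      letI : Algebra (traceField (Φ i)) E := (IntermediateField.inclusion (hE i)).toRingHom.toAlgebra
      reflexNormFinitePart (K i) (Φ i) (traceField (Φ i)) (ideleRelNorm (traceField (Φ i)) E (finiteIdeles E s))) = t) :
    ∃ ξ' : ∀ i, CMTypeUniformization (Φ i) (ideleMulIdealUnits (t i) (𝔞 i))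
        ((A i).conjugate σ.toRingEquiv) (((A i).endConjugate σ.toRingEquiv).comp (ιA i)),
      ∀ (i : I) (u v : K i),
        ideleMulEquiv (t i) (𝔞 i : FractionalIdeal (𝓞 (K i))⁰ (K i)) (𝔞 i).ne_zero (Submodule.Quotient.mk u) =
            Submodule.Quotient.mk v →
          (A i).conjPoints σ.toRingEquiv ((ξ i).r u) = (ξ' i).r v := by
  subst ht
  exact shimura1998_thm18_6_family_of_isArtinCorrespondent h186 K Φ E hE 𝔞 A ιA ξ σ s hs

/-- **[Shimura 1998, Thm. 18.6] for a family over `E ⊇ E*(Φᵢ)`, lattices `N_{E,Φᵢ}(s)·𝔞ᵢ`** — the conclusion of ★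
`shimura1998_thm18_6_family_of_isArtinCorrespondent` with the reflex norms in the currency of ★ `CMStructure.cmRecipMatrix`
(`reflexNormFiniteIdele (K i) (Φ i) E s`): for structures `(Aᵢ, ιᵢ, ξᵢ)` of types `(Kᵢ, Φᵢ, 𝔞ᵢ)`, `σ ∈ Aut(ℂ/E)` and `s ∈ 𝔸_{E,f}^×`
with `art_E(s) = σ|E^ab`, there are uniformisations `ξ′ᵢ` of `(Aᵢ^σ, ιᵢ^σ)` of types `(Kᵢ, Φᵢ, N_{E,Φᵢ}(s)·𝔞ᵢ)` with the (18.3a)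
torsion clause. [cite: Shimura1998, §18.6 Thm. 18.6 (1)–(2) pp. 124–125] [cite: Milne2005ShimuraVarieties, Def. 12.8 (60)–(62) p. 114]
[cite: Deligne1971TravauxShimura, 4.18–4.21 pp. 150–152] -/
theorem shimura1998_thm18_6_family_reflexNormFiniteIdele (h186 : shimura1998_thm18_6)
    {I : Type} (K : I → Type) [∀ i, Field (K i)] [∀ i, NumberField (K i)] [∀ i, IsCMField (K i)]
    (Φ : ∀ i, CMType (K i)) [∀ i, NumberField (traceField (Φ i))]
    (E : IntermediateField ℚ ℂ) [NumberField E] (hE : ∀ i, traceField (Φ i) ≤ E)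
    (𝔞 : ∀ i, (FractionalIdeal (𝓞 (K i))⁰ (K i))ˣ) (A : I → AbelianVariety ℂ)
    (ιA : ∀ i, 𝓞 (K i) →+* End (A i)) (ξ : ∀ i, CMTypeUniformization (Φ i) (𝔞 i) (A i) (ιA i))
    (σ : ℂ ≃ₐ[E] ℂ) (s : (FiniteAdeleRing (𝓞 E) E)ˣ) (hs : IsArtinCorrespondent E (algebraMap E ℂ) s σ.toRingEquiv) :
    ∃ ξ' : ∀ i, CMTypeUniformization (Φ i) (ideleMulIdealUnits (reflexNormFiniteIdele (K i) (Φ i) E s) (𝔞 i))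
        ((A i).conjugate σ.toRingEquiv) (((A i).endConjugate σ.toRingEquiv).comp (ιA i)),
      ∀ (i : I) (u v : K i),
        ideleMulEquiv (reflexNormFiniteIdele (K i) (Φ i) E s) (𝔞 i : FractionalIdeal (𝓞 (K i))⁰ (K i)) (𝔞 i).ne_zero
            (Submodule.Quotient.mk u) = Submodule.Quotient.mk v →
          (A i).conjPoints σ.toRingEquiv ((ξ i).r u) = (ξ' i).r v :=
  family_of_eq h186 K Φ E hE 𝔞 A ιA ξ σ s hs _
    (funext fun i => reflexNormFinitePart_ideleRelNorm_finiteIdeles (K i) (Φ i) E (hE i) s)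

end Literature.NumberTheory.ComplexMultiplication

end
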